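import Summits.BirchSwinnertonDyer.BirchSwinnertonDyer.Theorems.Rank2Observatory2DescClCertBasic
import Summits.BirchSwinnertonDyer.BirchSwinnertonDyer.Theorems.Rank2Observatory2DescClSweepCert
import Summits.BirchSwinnertonDyer.BirchSwinnertonDyer.Theorems.Rank2Observatory2DescClInert
import Summits.BirchSwinnertonDyer.BirchSwinnertonDyer.Theorems.Rank2Observatory2DescClIndexCertPrime
import HarnessLib

/-!
# BirchSwinnertonDyer — rank ≥ 2 observatory: KERNEL-2DESC-CL v2.0 — the prime-entry certificate (Dedekind–Kummer data of one rational prime)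

HONEST FRAMING: per-curve certified theorems and census instruments; no claim on BSD in rank ≥ 2.

Second generic file of the reflective reshape of the class-group-general kernel 2-descent (cell `b2b-bsdr2`,
seat cert-1; design `b2b-bsdr2-cert-1/KERNEL-2DESC-CL.md` §7).  A `TwoDescCl.PrimeEntry` is the per-field
REGISTRY ROW of one rational prime `p` in a monogenic cubic field `K = ℚ(α)`, `g(α) = 0`,
`g = X³ + aX² + bX + c`: its decomposition type (`kind = 0` split with roots `r₀, r₁, r₂`; `1` a linear times an
irreducible quadratic factor, root `r` and `X² + uX + v`; `2` inert), the integer cofactor polynomial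
`s₀ + s₁X + s₂X²` of the congruence `g ≡ (factorisation) (mod p)`, and the per-prime INDEX CERTIFICATE
(`p² ∤ Δ(g)`, else the normalised local battery `localCertOKNorm`, p335265).  The Boolean `PrimeEntry.check`
verifies the row by integer arithmetic; `codes` lists the prime-ideal codes `(p, G)` of the primes above `p`;
the soundness theorems `mem_primesOver_of_check` / `absNorm_of_check` / `cover_of_check` say that these codes
present exactly the primes of `𝓞 K` above `p`, with residue degrees `codeDeg`, from the tree's Dedekind–Kummer
layer (`primesOver_split`, `primesOver_one_two_of_no_root`, p309333; `primesOver_inert`, p314136) and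
`not_dvd_exponent_of_not_sq_dvd` / `not_dvd_exponent_of_localCertNorm` (p335592).  Primality of `p` stays a
hypothesis (discharged by `norm_num` in the row files, outside the kernel).

Sorry-free; axioms `propext`, `Classical.choice`, `Quot.sound`.
[cite: Cohen1993, §4.8.2, Thm. 4.8.13 (Dedekind–Kummer); §6.2 (index)] [cite: Marcus2018, Ch. 3, Thm. 27]
-/

set_option linter.dupNamespace false

noncomputable section

open scoped Classical NumberField nonZeroDivisors

open Literature.NumberTheory.NumberFields Polynomial Module NumberField IsDedekindDomain Ideal

namespace Summit.BirchSwinnertonDyer.BirchSwinnertonDyer.Rank2Observatory.TwoDescCl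

open TwoDescCubic

/-! ## Residue checks -/

/-- `X² + uX + v` has no root modulo `p`, on representatives. Computable. [folklore] -/
def noRootQuadMod (p : ℕ) (u v : ℤ) : Bool :=
  decide (0 < p) && (List.range p).all fun t => ((t : ℤ) ^ 2 + u * (t : ℤ) + v) % (p : ℤ) != 0

/-- Soundness of `noRootQuadMod`. [folklore] -/
theorem no_root_of_noRootQuadMod {p : ℕ} {u v : ℤ} (h : noRootQuadMod p u v = true) :
    ∀ t : ZMod p, t ^ 2 + (u : ZMod p) * t + (v : ZMod p) ≠ 0 := by
  simp only [noRootQuadMod, Bool.and_eq_true, decide_eq_true_eq, List.all_eq_true, List.mem_range] at h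
  obtain ⟨hp, hall⟩ := h
  haveI : NeZero p := ⟨hp.ne'⟩
  intro t ht
  have hne := bne_iff_ne.mp (hall t.val (ZMod.val_lt t))
  apply hne
  have hc : ((((t.val : ℕ) : ℤ) ^ 2 + u * ((t.val : ℕ) : ℤ) + v : ℤ) : ZMod p) = 0 := by
    push_cast
    rw [ZMod.natCast_zmod_val]
    exact ht
  exact (ZMod.intCast_zmod_eq_zero_iff_dvd _ p).mp hc |> Int.emod_eq_zero_of_dvd

/-! ## The prime entry -/

/-- **A registry element** `g = g₀ + g₁α + g₂α²` attached to the prime `P = (p, G(α))` of its row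
(`code = G`): `(g) = P · W₁^e` exactly, certified by `g · δ = (p·q)^k` (support above `p, q`), an inverse
triple at `W₂` and at every other prime above `p` (`invs`), the `q`-adic order `e` of `N(g)`, and the real
sign bit `sg`. Pure data; verified by `ClFieldCert.check`. [cite: Cohen1993, §6.5] -/
structure ElemEntry where
  /-- `G` of the own prime `(p, G(α))` -/
  code : ℤ × ℤ × ℤ
  /-- coordinates of `g` -/
  g : ℤ × ℤ × ℤ
  /-- sign bit at the real place (`true` = negative) -/
  sg : Bool
  /-- cofactor `δ` with `g · δ = (p·q)^k` -/
  δ : ℤ × ℤ × ℤ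
  /-- the exponent `k` -/
  k : ℕ
  /-- `e = ord_{W₁}(g)` (`|N g| = q^e · m`, `q ∤ m`, `g ∉ W₂`) -/
  e : ℕ
  /-- inverse triple at `W₂` -/
  inv2 : ℤ × ℤ × ℤ
  /-- inverse triples at the other primes above `p` -/
  invs : List (ℤ × ℤ × ℤ)


/-- **Registry row of one rational prime** `p`: decomposition `kind` (`0` split, `1` linear × quadratic,
`2` inert), root data `r` (`(r₀, r₁, r₂)` resp. `(r, u, v)`), cofactor polynomial `s = (s₀, s₁, s₂)` of
`g − (factorisation) = p · (s₀ + s₁X + s₂X²)`. [cite: Cohen1993, §4.8.2] -/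
structure PrimeEntry where
  /-- the rational prime -/
  p : ℕ
  /-- decomposition type: `0` split, `1` linear × irreducible quadratic, `2` inert -/
  kind : ℕ
  /-- roots `(r₀, r₁, r₂)` (split) or `(r, u, v)` (type `1`); unused for inert -/
  r : ℤ × ℤ × ℤ
  /-- cofactor polynomial coefficients `(s₀, s₁, s₂)` -/
  s : ℤ × ℤ × ℤ
  /-- class certificates `(x, y, z, j)` of the codes inside the Minkowski range (`classCheck`) -/
  cls : List (ℤ × ℤ × ℤ × ℕ)
  /-- the registry elements `g_P` attached to (some of) the primes above `p` (`ElemEntry`) -/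
  els : List ElemEntry

namespace PrimeEntry

/-- The prime-ideal codes above `p`, without repetition. [cite: Cohen1993, §4.8.2] -/
def codes (e : PrimeEntry) : List PCode :=
  if e.kind = 0 then ([e.r.1, e.r.2.1, e.r.2.2].map fun r => ((e.p, -r, 1, 0) : PCode)).dedup
  else if e.kind = 1 then [(e.p, -e.r.1, 1, 0), (e.p, e.r.2.2, e.r.2.1, 1)]
  else [(e.p, 0, 0, 0)]

/-- The Dedekind–Kummer congruences of the row, as integer equalities. Computable. [cite: Cohen1993, §4.8.2] -/
def dkCheck (a b c : ℤ) (e : PrimeEntry) : Bool :=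
  if e.kind = 0 then
    decide (a + (e.r.1 + e.r.2.1 + e.r.2.2) = e.p * e.s.2.2 ∧
      b - (e.r.1 * e.r.2.1 + e.r.1 * e.r.2.2 + e.r.2.1 * e.r.2.2) = e.p * e.s.2.1 ∧
      c + e.r.1 * e.r.2.1 * e.r.2.2 = e.p * e.s.1)
  else if e.kind = 1 then
    decide (a - (e.r.2.1 - e.r.1) = e.p * e.s.2.2 ∧ b - (e.r.2.2 - e.r.1 * e.r.2.1) = e.p * e.s.2.1 ∧
      c + e.r.1 * e.r.2.2 = e.p * e.s.1) && noRootQuadMod e.p e.r.2.1 e.r.2.2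
  else decide (e.kind = 2) && noRootMod e.p a b c

/-- The per-prime index certificate: `p² ∤ Δ(g)`, else the normalised local battery. Computable.
[cite: Marcus2018, Ch. 2, Exercise 27; Ch. 3, Thm. 27] -/
def indexCheck (a b c : ℤ) (p : ℕ) : Bool :=
  !decide (((p : ℤ)) ^ 2 ∣ MonicCubic.disc a b c) || localCertOKNorm a b c p

/-- The whole row check. Computable. [cite: Cohen1993, §4.8.2] -/
def check (a b c : ℤ) (e : PrimeEntry) : Bool :=
  decide (1 < e.p) && indexCheck a b c e.p && dkCheck a b c e

end PrimeEntry

/-- Residue degree of a code: `2` for `G = α² + uα + v`, `1` for `G = α + g₀`, `3` for the inert code. -/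
def codeDeg (C : PCode) : ℕ :=
  if C.2.2.2 = 1 then 2 else if C.2.2.1 = 1 ∧ C.2.2.2 = 0 then 1 else 3

variable {K : Type*} [Field K] [NumberField K] {a b c : ℤ} {θ : K}

/-- `p ∤ exponent(α)` from the per-prime index certificate. [cite: Marcus2018, Ch. 3, Thm. 27] -/
theorem not_dvd_exponent_of_indexCheck (hirr : Irreducible (MonicCubic.polyQ a b c))
    (hθ : aeval θ (MonicCubic.poly a b c) = 0) (h3 : finrank ℚ K = 3) {p : ℕ} (hp : p.Prime)
    (h : PrimeEntry.indexCheck a b c p = true) :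
    ¬ p ∣ RingOfIntegers.exponent (MonicCubic.thetaInt hθ) := by
  simp only [PrimeEntry.indexCheck, Bool.or_eq_true, Bool.not_eq_eq_eq_not, Bool.not_true,
    decide_eq_false_iff_not] at h
  rcases h with h | h
  · exact not_dvd_exponent_of_not_sq_dvd hirr hθ h3 p hp h
  · exact not_dvd_exponent_of_localCertNorm hirr hθ h3 p hp h

omit [NumberField K] in
/-- The inert code presents `(p)`. [folklore] -/
theorem idealOf_inert (hθ : aeval θ (MonicCubic.poly a b c) = 0) (p : ℕ) :
    idealOf hθ ((p, 0, 0, 0) : PCode) = span {(p : 𝓞 K)} := by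
  simp only [idealOf]
  have h0 : lin hθ 0 0 0 = 0 := by simp [lin]
  rw [h0, Ideal.span_pair_zero]

/-- **Soundness of the prime entry (split / type `1` / inert, uniformly)**: every code of the row presents a
prime above `p` of norm `p ^ codeDeg`, and every prime above `p` is presented by a code of the row.
[cite: Cohen1993, §4.8.2, Thm. 4.8.13] -/
theorem primeEntry_sound (hirr : Irreducible (MonicCubic.polyQ a b c))
    (hθ : aeval θ (MonicCubic.poly a b c) = 0) (h3 : finrank ℚ K = 3) (e : PrimeEntry) (hp : e.p.Prime)
    (h : e.check a b c = true) :
    (∀ C ∈ e.codes, idealOf hθ C ∈ primesOver (span {(e.p : ℤ)}) (𝓞 K) ∧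
        absNorm (idealOf hθ C) = e.p ^ codeDeg C) ∧
      ∀ P : Ideal (𝓞 K), P.IsPrime → (e.p : 𝓞 K) ∈ P → ∃ C ∈ e.codes, P = idealOf hθ C := by
  simp only [PrimeEntry.check, Bool.and_eq_true, decide_eq_true_eq] at h
  obtain ⟨⟨-, hidx⟩, hdk⟩ := h
  have hexp := not_dvd_exponent_of_indexCheck hirr hθ h3 hp hidx
  obtain ⟨p, kind, ⟨r₀, r₁, r₂⟩, ⟨s₀, s₁, s₂⟩, cls, els⟩ := e
  simp only at hp hexp hdk ⊢
  unfold PrimeEntry.dkCheck at hdk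
  simp only at hdk
  by_cases h0 : kind = 0
  · subst h0
    simp only [↓reduceIte, decide_eq_true_eq] at hdk
    obtain ⟨e₂, e₁, e₀⟩ := hdk
    have hfac := poly_eq_prod_three_add a b c p r₀ r₁ r₂ s₀ s₁ s₂ e₂ e₁ e₀
    obtain ⟨hP, hcov⟩ := primesOver_split hirr hθ hp hexp _ _ hfac
    have hcodes : PrimeEntry.codes ⟨p, 0, (r₀, r₁, r₂), (s₀, s₁, s₂), cls, els⟩ =
        ([r₀, r₁, r₂].map fun r => ((p, -r, 1, 0) : PCode)).dedup := by simp [PrimeEntry.codes]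
    refine ⟨fun C hC => ?_, fun P hPr hpP => ?_⟩
    · rw [hcodes, List.mem_dedup, List.mem_map] at hC
      obtain ⟨r, hr, rfl⟩ := hC
      simp only [List.mem_cons, List.not_mem_nil, or_false] at hr
      have hdeg : codeDeg ((p, -r, 1, 0) : PCode) = 1 := by simp [codeDeg]
      rw [hdeg, pow_one]
      rcases hr with rfl | rfl | rfl
      · exact hP 0
      · exact hP 1
      · exact hP 2
    · obtain ⟨i, hi⟩ := hcov P hPr hpP
      refine ⟨(p, -((![r₀, r₁, r₂] : Fin 3 → ℤ) i), 1, 0), ?_, hi⟩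
      rw [hcodes, List.mem_dedup, List.mem_map]
      refine ⟨(![r₀, r₁, r₂] : Fin 3 → ℤ) i, ?_, rfl⟩
      fin_cases i <;> simp
  by_cases h1 : kind = 1
  · subst h1
    simp only [one_ne_zero, ↓reduceIte, Bool.and_eq_true, decide_eq_true_eq] at hdk
    obtain ⟨⟨e₂, e₁, e₀⟩, hnr⟩ := hdk
    have hfac := poly_eq_lin_mul_quad_add a b c p r₀ r₁ r₂ s₀ s₁ s₂ e₂ e₁ e₀
    obtain ⟨hP₁, hP₂, hcov⟩ :=
      primesOver_one_two_of_no_root hirr hθ hp hexp r₀ r₁ r₂ _ hfac (no_root_of_noRootQuadMod hnr)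
    have hcodes : PrimeEntry.codes ⟨p, 1, (r₀, r₁, r₂), (s₀, s₁, s₂), cls, els⟩ =
        [((p, -r₀, 1, 0) : PCode), (p, r₂, r₁, 1)] := by simp [PrimeEntry.codes]
    refine ⟨fun C hC => ?_, fun P hPr hpP => ?_⟩
    · rw [hcodes] at hC
      simp only [List.mem_cons, List.not_mem_nil, or_false] at hC
      rcases hC with rfl | rfl
      · have hdeg : codeDeg ((p, -r₀, 1, 0) : PCode) = 1 := by simp [codeDeg]
        rw [hdeg, pow_one]; exact hP₁
      · have hdeg : codeDeg ((p, r₂, r₁, 1) : PCode) = 2 := by simp [codeDeg]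
        rw [hdeg]; exact hP₂
    · rcases hcov P hPr hpP with hi | hi
      · exact ⟨(p, -r₀, 1, 0), by rw [hcodes]; simp, hi⟩
      · exact ⟨(p, r₂, r₁, 1), by rw [hcodes]; simp, hi⟩
  · simp only [h0, h1, ↓reduceIte, Bool.and_eq_true, decide_eq_true_eq] at hdk
    obtain ⟨rfl, hnr⟩ := hdk
    obtain ⟨hP, hcov⟩ := primesOver_inert hirr hθ h3 hp hexp (no_root_of_noRootMod hnr)
    have hcodes : PrimeEntry.codes ⟨p, 2, (r₀, r₁, r₂), (s₀, s₁, s₂), cls, els⟩ = [((p, 0, 0, 0) : PCode)] := by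
      simp [PrimeEntry.codes]
    refine ⟨fun C hC => ?_, fun P hPr hpP => ⟨(p, 0, 0, 0), by rw [hcodes]; simp, ?_⟩⟩
    · rw [hcodes, List.mem_singleton] at hC
      subst hC
      have hdeg : codeDeg ((p, 0, 0, 0) : PCode) = 3 := by simp [codeDeg]
      rw [hdeg, idealOf_inert]
      exact hP
    · rw [idealOf_inert]; exact hcov P hPr hpP

/-- Every code of a checked row presents a prime above `p`. [cite: Cohen1993, §4.8.2] -/
theorem mem_primesOver_of_check (hirr : Irreducible (MonicCubic.polyQ a b c))
    (hθ : aeval θ (MonicCubic.poly a b c) = 0) (h3 : finrank ℚ K = 3) {e : PrimeEntry} (hp : e.p.Prime)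
    (h : e.check a b c = true) {C : PCode} (hC : C ∈ e.codes) :
    idealOf hθ C ∈ primesOver (span {(e.p : ℤ)}) (𝓞 K) :=
  ((primeEntry_sound hirr hθ h3 e hp h).1 C hC).1

/-- The norm of a code's prime is `p ^ codeDeg`. [cite: Cohen1993, §4.8.2] -/
theorem absNorm_of_check (hirr : Irreducible (MonicCubic.polyQ a b c))
    (hθ : aeval θ (MonicCubic.poly a b c) = 0) (h3 : finrank ℚ K = 3) {e : PrimeEntry} (hp : e.p.Prime)
    (h : e.check a b c = true) {C : PCode} (hC : C ∈ e.codes) :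
    absNorm (idealOf hθ C) = e.p ^ codeDeg C :=
  ((primeEntry_sound hirr hθ h3 e hp h).1 C hC).2

/-- The codes of a checked row cover the primes above `p`. [cite: Cohen1993, §4.8.2, Thm. 4.8.13] -/
theorem cover_of_check (hirr : Irreducible (MonicCubic.polyQ a b c))
    (hθ : aeval θ (MonicCubic.poly a b c) = 0) (h3 : finrank ℚ K = 3) {e : PrimeEntry} (hp : e.p.Prime)
    (h : e.check a b c = true) (P : Ideal (𝓞 K)) (hP : P.IsPrime) (hpP : (e.p : 𝓞 K) ∈ P) :
    ∃ C ∈ e.codes, P = idealOf hθ C :=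
  (primeEntry_sound hirr hθ h3 e hp h).2 P hP hpP

/-- The code's prime is prime and non-zero. [folklore] -/
theorem isPrime_and_ne_bot_of_check (hirr : Irreducible (MonicCubic.polyQ a b c))
    (hθ : aeval θ (MonicCubic.poly a b c) = 0) (h3 : finrank ℚ K = 3) {e : PrimeEntry} (hp : e.p.Prime)
    (h : e.check a b c = true) {C : PCode} (hC : C ∈ e.codes) :
    (idealOf hθ C).IsPrime ∧ idealOf hθ C ≠ ⊥ := by
  have hm := mem_primesOver_of_check hirr hθ h3 hp h hC
  exact ⟨hm.1, by
    rintro h0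
    have h1 := absNorm_of_check hirr hθ h3 hp h hC
    rw [h0, Ideal.absNorm_bot] at h1
    exact (pow_ne_zero _ hp.ne_zero) h1.symm⟩

/-- Every code of a row has first component `p`. [folklore] -/
theorem code_fst_of_mem {e : PrimeEntry} {C : PCode} (hC : C ∈ e.codes) : C.1 = e.p := by
  unfold PrimeEntry.codes at hC
  split_ifs at hC
  · rw [List.mem_dedup, List.mem_map] at hC
    obtain ⟨r, -, rfl⟩ := hC; rfl
  · simp only [List.mem_cons, List.not_mem_nil, or_false] at hC
    rcases hC with rfl | rfl <;> rfl
  · rw [List.mem_singleton] at hC; subst hC; rfl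

omit [NumberField K] in
/-- `p` lies in the prime presented by any of its codes. [folklore] -/
theorem natCast_mem_idealOf (hθ : aeval θ (MonicCubic.poly a b c) = 0) {e : PrimeEntry} {C : PCode}
    (hC : C ∈ e.codes) : (e.p : 𝓞 K) ∈ idealOf hθ C := by
  rw [← code_fst_of_mem hC]; exact Ideal.subset_span (by simp)

/-- **The height-one prime of a code** of a checked row. [folklore] -/
def primeOfCode (hirr : Irreducible (MonicCubic.polyQ a b c)) (hθ : aeval θ (MonicCubic.poly a b c) = 0)
    (h3 : finrank ℚ K = 3) {e : PrimeEntry} (hp : e.p.Prime) (h : e.check a b c = true) {C : PCode}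
    (hC : C ∈ e.codes) : HeightOneSpectrum (𝓞 K) :=
  ⟨idealOf hθ C, (isPrime_and_ne_bot_of_check hirr hθ h3 hp h hC).1,
    (isPrime_and_ne_bot_of_check hirr hθ h3 hp h hC).2⟩

/-- A height-one prime containing `p` is presented by a code of the row. [cite: Cohen1993, §4.8.2] -/
theorem exists_code_of_natCast_mem (hirr : Irreducible (MonicCubic.polyQ a b c))
    (hθ : aeval θ (MonicCubic.poly a b c) = 0) (h3 : finrank ℚ K = 3) {e : PrimeEntry} (hp : e.p.Prime)
    (h : e.check a b c = true) (w : HeightOneSpectrum (𝓞 K)) (hw : (e.p : 𝓞 K) ∈ w.asIdeal) :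
    ∃ C ∈ e.codes, w.asIdeal = idealOf hθ C :=
  cover_of_check hirr hθ h3 hp h w.asIdeal w.isPrime hw

/-! ## Class certificates of the Minkowski sweep -/

/-- **Class certificate of one code** relative to the auxiliary prime `q`: an element
`β = x + yα + zα² ∈ (p, G(α))` with `|N β| = N(p, G(α)) · q^j` (so the class of `(p, G(α))` lies in the
subgroup generated by the classes of the primes above `q`); inert codes need none (principal); a code with
`p^deg ≥ bM` (outside the Minkowski range) needs none either.  Data `(x, y, z, j)`. Computable.
[cite: Cohen1993, §6.5 (relations)] [cite: Marcus2018, Ch. 5, Cor. 2 to Thm. 35] -/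
def classCheck (a b c : ℤ) (q bM : ℕ) (C : PCode) (d : ℤ × ℤ × ℤ × ℕ) : Bool :=
  decide (bM ≤ C.1 ^ codeDeg C) || decide (codeDeg C = 3) ||
    (memCode C (d.1, d.2.1, d.2.2.1) &&
      decide ((normFormZ a b c d.1 d.2.1 d.2.2.1).natAbs = C.1 ^ codeDeg C * q ^ d.2.2.2))

/-- Soundness of the class certificate: `p ^ f(P) < bM → ClassIn ⟨primes ∋ q⟩ P` for the code's prime.
[cite: Marcus2018, Ch. 5, Cor. 2 to Thm. 35] -/
theorem classIn_of_classCheck (hirr : Irreducible (MonicCubic.polyQ a b c))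
    (hθ : aeval θ (MonicCubic.poly a b c) = 0) (h3 : finrank ℚ K = 3) {e : PrimeEntry} (hp : e.p.Prime)
    (h : e.check a b c = true) {C : PCode} (hC : C ∈ e.codes) {q : ℕ} (hq : q.Prime) {bM : ℕ}
    {d : ℤ × ℤ × ℤ × ℕ} (hd : classCheck a b c q bM C d = true)
    (hlt : e.p ^ (idealOf hθ C).inertiaDeg ℤ < bM) :
    ClassIn (Subgroup.closure {cc : ClassGroup (𝓞 K) | ∃ (J : Ideal (𝓞 K))
      (hJ : J ∈ (Ideal (𝓞 K))⁰), ((q : ℕ) : 𝓞 K) ∈ J ∧ ClassGroup.mk0 ⟨J, hJ⟩ = cc}) (idealOf hθ C) := by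
  have hPO := mem_primesOver_of_check hirr hθ h3 hp h hC
  have habs := absNorm_of_check hirr hθ h3 hp h hC
  have hfst := code_fst_of_mem hC
  simp only [classCheck, Bool.or_eq_true, Bool.and_eq_true, decide_eq_true_eq] at hd
  rcases hd with (hb | h3') | ⟨hmem, hN⟩
  · exact absurd hlt (not_pow_inertiaDeg_lt hPO habs (hfst ▸ hb))
  · -- inert: principal
    have hin : C = (C.1, 0, 0, 0) := by
      by_cases ha : C.2.2.2 = 1
      · simp [codeDeg, ha] at h3'
      by_cases hb : C.2.2.1 = 1 ∧ C.2.2.2 = 0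
      · simp [codeDeg, hb] at h3'
      clear h3'
      obtain ⟨p', g₀, g₁, g₂⟩ := C
      simp only at ha hb ⊢
      -- membership in `codes` pins the shape down
      unfold PrimeEntry.codes at hC
      split_ifs at hC
      · rw [List.mem_dedup, List.mem_map] at hC
        obtain ⟨r, -, hr⟩ := hC
        simp only [Prod.mk.injEq] at hr
        exact absurd ⟨hr.2.2.1.symm, hr.2.2.2.symm⟩ hb
      · simp only [List.mem_cons, List.not_mem_nil, or_false, Prod.mk.injEq] at hC
        rcases hC with hr | hr
        · exact absurd ⟨hr.2.2.1, hr.2.2.2⟩ hb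
        · exact absurd hr.2.2.2 ha
      · simp only [List.mem_singleton, Prod.mk.injEq] at hC
        obtain ⟨-, h₀, h₁, h₂⟩ := hC
        rw [h₀, h₁, h₂]
    rw [hin, hfst, idealOf_inert]
    exact ClassIn.span_singleton _ _
  · have hβ := lin_mem_idealOf_of_memCode hθ C _ hmem
    have hP := isPrime_and_ne_bot_of_check hirr hθ h3 hp h hC
    refine classIn_tsupp_of_rel hq hP.2 hβ d.2.2.2 ?_
    rw [natAbs_norm_lin_coords hirr hθ h3, habs, ← hfst]
    exact hN

end Summit.BirchSwinnertonDyer.BirchSwinnertonDyer.Rank2Observatory.TwoDescCl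

end
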